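import Summits.AtomisticToContinuum.HydrodynamicLimit.Theorems.EquilibriumClampedCollisionalWindowLD.Negative.PulseParams

/-!
# Newton-cradle pulse, part 4: the invariant and one step of it (helper file, refutation of `EquilibriumClampedCollisionalWindowLD`, stmt-AtomisticToContinuum-13733, layer L3; see `Cruxes/EquilibriumClampedCollisionalWindowLD/Disproof.lean`, evidence WITNESS.md §4.3; no Theses declaration is asserted; refuter-cdisprove-stmt-AtomisticToContinuum-13733-0)

`DataOK`, `Inv`, `inv_zero`, `StepGeom`/`stepGeom_of_inv`, `StepContact`/`stepContact_of_geom`.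
-/

noncomputable section

open Real
open scoped InnerProductSpace

namespace Summit.AtomisticToContinuum.HydrodynamicLimit.Theorems

namespace EquilibriumClampedCollisionalWindowLDNegative

section BlockAll

variable {E : Type*} [NormedAddCommGroup E] [InnerProductSpace ℝ E]

section BlockAnalysis

variable {P : Params} {e : E} {D : BlockData E}

/-- Bounds on the data of a block. -/
structure DataOK (P : Params) (e : E) (D : BlockData E) : Prop where
  e_unit : ‖e‖ = 1
  ξ_le : ∀ k, k ≤ P.K → ‖D.ξ k‖ ≤ P.r
  η_le : ∀ k, 1 ≤ k → k ≤ P.K → ‖D.η k‖ ≤ P.u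
  η0_le : ‖D.η 0 - P.V • e‖ ≤ P.u

/-- The invariant of the pulse after `k` transfers. -/
structure Inv (P : Params) (e : E) (D : BlockData E) (k : ℕ) : Prop where
  t_ge : (k : ℝ) * P.θlo ≤ tHit P e D k
  t_le : tHit P e D k ≤ (k : ℝ) * P.θhi
  speed : |‖(carrier P e D k).W‖ - P.V| ≤ P.u + k * P.dV
  dir : ‖(‖(carrier P e D k).W‖)⁻¹ • (carrier P e D k).W - e‖ ≤ P.αs
  p_eq : (carrier P e D k).p = base P e D k + tHit P e D k • D.η k

/-- The invariant holds for the driver. [folklore] -/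
theorem inv_zero (hP : P.Admissible) (hD : DataOK P e D) : Inv P e D 0 := by
  have hV := hP.V_pos
  have hu8 := hP.u_le
  have hη0 := hD.η0_le
  have hVe : ‖P.V • e‖ = P.V := by
    rw [norm_smul, hD.e_unit, mul_one, Real.norm_of_nonneg hV.le]
  refine ⟨by simp, by simp, ?_, ?_, ?_⟩
  · simp only [carrier_zero_W, Nat.cast_zero, zero_mul, add_zero]
    rw [← hVe]
    exact (abs_norm_sub_norm_le _ _).trans hη0
  · -- direction of the driver velocity
    simp only [carrier_zero_W]
    have hlt : ‖D.η 0 - P.V • e‖ < P.V := lt_of_le_of_lt hη0 (by linarith)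
    have h := norm_normalize_sub_le (n := e) (η := D.η 0 - P.V • e) hD.e_unit hlt
    rw [add_sub_cancel] at h
    refine h.trans (le_trans ?_ hP.two_u_div_le_αs)
    have hclo := hP.clo_le_Vlo
    have hVlo : P.Vlo ≤ P.V - 2 * P.u := by
      have := hP.dV_nn; unfold Params.Vlo
      have : (0:ℝ) ≤ P.K * P.dV := by positivity
      linarith
    have hcu := hP.u_lt_clo
    have hu := hP.u_nn
    -- `2 ‖η₀ - V e‖/(V - ‖η₀ - V e‖) ≤ 2u/(V - u) ≤ 2u/(clo - u)`
    calc 2 * ‖D.η 0 - P.V • e‖ / (P.V - ‖D.η 0 - P.V • e‖)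
        ≤ 2 * P.u / (P.V - P.u) := by
          rw [div_le_div_iff₀ (by linarith) (by linarith)]
          have := norm_nonneg (D.η 0 - P.V • e)
          nlinarith
      _ ≤ 2 * P.u / (P.clo - P.u) :=
          div_le_div_of_nonneg_left (by positivity) (by linarith) (by linarith)
  · simp [base]

/-- Stage-`k` bounds on the carrier and on the relative data of the transfer `k → k+1`. -/
structure StepGeom (P : Params) (e : E) (D : BlockData E) (k : ℕ) : Prop where
  t_nn : 0 ≤ tHit P e D k
  t_le_T : tHit P e D k ≤ P.Tmax
  W_ge : P.V - P.u - k * P.dV ≤ ‖(carrier P e D k).W‖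
  W_le : ‖(carrier P e D k).W‖ ≤ P.V + P.u + k * P.dV
  W_ge' : P.Vlo + P.u ≤ ‖(carrier P e D k).W‖
  W_le' : ‖(carrier P e D k).W‖ + P.u ≤ P.Vhi
  U_ge' : ‖(carrier P e D k).W‖ - P.u ≤ ‖relVel D k (carrier P e D k)‖
  U_le' : ‖relVel D k (carrier P e D k)‖ ≤ ‖(carrier P e D k).W‖ + P.u
  U_dir : ‖(‖relVel D k (carrier P e D k)‖)⁻¹ • relVel D k (carrier P e D k) - e‖ ≤ P.αp
  Δ_eq : relPos P e D k (carrier P e D k) = P.s • e +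
    (D.ξ (k + 1) - D.ξ k + tHit P e D k • (D.η (k + 1) - D.η k))
  Δ_le : ‖D.ξ (k + 1) - D.ξ k + tHit P e D k • (D.η (k + 1) - D.η k)‖ ≤ P.δs
  η_le : ‖D.η (k + 1)‖ ≤ P.u

/-- The relative speed is at least `Vlo`. [folklore] -/
theorem StepGeom.U_ge {k : ℕ} (h : StepGeom P e D k) : P.Vlo ≤ ‖relVel D k (carrier P e D k)‖ := by
  have := h.W_ge'; have := h.U_ge'; linarith

/-- The relative speed is at most `Vhi`. [folklore] -/
theorem StepGeom.U_le {k : ℕ} (h : StepGeom P e D k) : ‖relVel D k (carrier P e D k)‖ ≤ P.Vhi := by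
  have := h.W_le'; have := h.U_le'; linarith

set_option maxHeartbeats 800000 in
/-- The invariant at stage `k` gives the stage-`k` geometric bounds. [folklore] -/
theorem stepGeom_of_inv (hP : P.Admissible) (hD : DataOK P e D) {k : ℕ} (hk : Inv P e D k)
    (hkK : k + 1 ≤ P.K) : StepGeom P e D k := by
  set c := carrier P e D k with hc
  have hUdef : relVel D k c = c.W - D.η (k + 1) := rfl
  have hε := hP.ε_pos
  have hV := hP.V_pos
  have hu := hP.u_nn
  have he := hD.e_unit
  have hkK' : k ≤ P.K := (Nat.le_succ k).trans hkK
  have hk1 : (1 : ℕ) ≤ k + 1 := Nat.succ_le_succ (Nat.zero_le _)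
  have hKcast : (k : ℝ) ≤ P.K := by exact_mod_cast hkK'
  have hdV := hP.dV_nn
  have hθhi := hP.θhi_pos
  -- time bounds of the current carrier
  have ht0 : 0 ≤ tHit P e D k := by
    have h1 := hk.t_ge
    have h2 : (0:ℝ) ≤ k * P.θlo := mul_nonneg (Nat.cast_nonneg k) hP.θlo_pos.le
    linarith
  have htT : tHit P e D k ≤ P.Tmax := by
    refine hk.t_le.trans (le_trans ?_ hP.T_ge)
    exact mul_le_mul_of_nonneg_right hKcast hθhi.le
  -- speed bounds of the current carrier
  have hWlo : P.V - P.u - k * P.dV ≤ ‖c.W‖ := by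
    have := (abs_le.1 hk.speed).1; linarith
  have hWhi : ‖c.W‖ ≤ P.V + P.u + k * P.dV := by
    have := (abs_le.1 hk.speed).2; linarith
  have hkdV : (k : ℝ) * P.dV ≤ P.K * P.dV := mul_le_mul_of_nonneg_right hKcast hdV
  have hWVlo : P.Vlo + P.u ≤ ‖c.W‖ := by unfold Params.Vlo; linarith
  have hWVhi : ‖c.W‖ + P.u ≤ P.Vhi := by unfold Params.Vhi; linarith
  have hVlo := hP.Vlo_pos
  have hWpos : 0 < ‖c.W‖ := by linarith
  -- the target's data
  have hη1 : ‖D.η (k + 1)‖ ≤ P.u := hD.η_le (k + 1) hk1 hkK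
  have hξ1 : ‖D.ξ (k + 1)‖ ≤ P.r := hD.ξ_le (k + 1) hkK
  have hξ0 : ‖D.ξ k‖ ≤ P.r := hD.ξ_le k hkK'
  -- the relative velocity: size and direction
  have hUlo : ‖c.W‖ - P.u ≤ ‖relVel D k c‖ := by
    have := norm_sub_norm_le c.W (D.η (k + 1)); rw [hUdef]; linarith
  have hUhi : ‖relVel D k c‖ ≤ ‖c.W‖ + P.u := by
    rw [hUdef]
    calc ‖c.W - D.η (k + 1)‖ ≤ ‖c.W‖ + ‖D.η (k + 1)‖ := norm_sub_le _ _
      _ ≤ ‖c.W‖ + P.u := by linarith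
  have hUdir : ‖(‖relVel D k c‖)⁻¹ • relVel D k c - e‖ ≤ P.αp := by
    -- `U = ‖W‖ Ŵ + (-η)`, direction moves by ≤ 2u/(‖W‖ - u) ≤ 4u/V
    have hWdec : relVel D k c = ‖c.W‖ • ((‖c.W‖)⁻¹ • c.W) + (-D.η (k + 1)) := by
      rw [smul_smul, mul_inv_cancel₀ hWpos.ne', one_smul, hUdef, sub_eq_add_neg]
    have hŴ : ‖(‖c.W‖)⁻¹ • c.W‖ = 1 := by
      rw [norm_smul, norm_inv, norm_norm, inv_mul_cancel₀ hWpos.ne']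
    have hηlt : ‖-D.η (k + 1)‖ < ‖c.W‖ := by rw [norm_neg]; linarith
    have h1 := norm_normalize_sub_le (n := (‖c.W‖)⁻¹ • c.W) (η := -D.η (k + 1)) hŴ hηlt
    rw [← hWdec, norm_neg] at h1
    have h2 : 2 * ‖D.η (k + 1)‖ / (‖c.W‖ - ‖D.η (k + 1)‖) ≤ 4 * P.u / P.V := by
      rw [div_le_div_iff₀ (by linarith) hV]
      have hVlo2 := hP.Vlo_ge
      have hη0 := norm_nonneg (D.η (k + 1))
      have hprod : 4 * P.u * (P.V / 2) ≤ 4 * P.u * (‖c.W‖ - ‖D.η (k + 1)‖) :=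
        mul_le_mul_of_nonneg_left (by linarith) (by linarith)
      have hprod2 : 2 * ‖D.η (k + 1)‖ * P.V ≤ 2 * P.u * P.V :=
        mul_le_mul_of_nonneg_right (by linarith) hV.le
      linarith
    calc ‖(‖relVel D k c‖)⁻¹ • relVel D k c - e‖
        ≤ ‖(‖relVel D k c‖)⁻¹ • relVel D k c - (‖c.W‖)⁻¹ • c.W‖ + ‖(‖c.W‖)⁻¹ • c.W - e‖ :=
          norm_sub_le_norm_sub_add_norm_sub _ _ _
      _ ≤ 4 * P.u / P.V + P.αs := add_le_add (h1.trans h2) hk.dir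
      _ = P.αp := by unfold Params.αp; ring
  -- the relative position: `a = s e + Δ` with `‖Δ‖ ≤ δs`
  have haΔ : relPos P e D k c = P.s • e +
      (D.ξ (k + 1) - D.ξ k + tHit P e D k • (D.η (k + 1) - D.η k)) := by
    rw [relPos, hk.p_eq, base, base]
    simp only [Nat.cast_add, Nat.cast_one, tHit]
    rw [smul_sub]
    module
  have hΔle : ‖D.ξ (k + 1) - D.ξ k + tHit P e D k • (D.η (k + 1) - D.η k)‖ ≤ P.δs := by
    -- the term `t_k (η_{k+1} - η_k)`: zero for `k = 0`, else `≤ Tmax · 2u`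
    have hterm : ‖tHit P e D k • (D.η (k + 1) - D.η k)‖ ≤ 2 * P.Tmax * P.u := by
      rcases Nat.eq_zero_or_pos k with hk0 | hkpos
      · subst hk0
        simp only [tHit_zero, zero_smul, norm_zero]
        have := hP.T_nn; positivity
      · have hηk : ‖D.η k‖ ≤ P.u := hD.η_le k hkpos hkK'
        rw [norm_smul, Real.norm_of_nonneg ht0]
        calc tHit P e D k * ‖D.η (k + 1) - D.η k‖ ≤ P.Tmax * (P.u + P.u) := by
              refine mul_le_mul htT ((norm_sub_le _ _).trans (add_le_add hη1 hηk))
                (norm_nonneg _) hP.T_nn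
          _ = 2 * P.Tmax * P.u := by ring
    calc ‖D.ξ (k + 1) - D.ξ k + tHit P e D k • (D.η (k + 1) - D.η k)‖
        ≤ ‖D.ξ (k + 1) - D.ξ k‖ + ‖tHit P e D k • (D.η (k + 1) - D.η k)‖ := norm_add_le _ _
      _ ≤ (P.r + P.r) + 2 * P.Tmax * P.u :=
          add_le_add ((norm_sub_le _ _).trans (add_le_add hξ1 hξ0)) hterm
      _ = P.δs := by unfold Params.δs; ring
  exact ⟨ht0, htT, hWlo, hWhi, hWVlo, hWVhi, hUlo, hUhi, hUdir, haΔ, hΔle, hη1⟩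

/-- The contact of the transfer `k → k+1`. -/
structure StepContact (P : Params) (e : E) (D : BlockData E) (k : ℕ) : Prop where
  p_le : ‖perpC (relPos P e D k (carrier P e D k)) (relVel D k (carrier P e D k))‖ ≤ P.ps
  θ_pos : 0 < θk P e D k
  θ_ge : P.θlo ≤ θk P e D k
  θ_le : θk P e D k ≤ P.θhi
  contact : ‖relPos P e D k (carrier P e D k) - θk P e D k • relVel D k (carrier P e D k)‖ = P.ε
  before : ∀ θ, 0 ≤ θ → θ < θk P e D k →
    P.ε < ‖relPos P e D k (carrier P e D k) - θ • relVel D k (carrier P e D k)‖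
  n_unit : ‖nk P e D k‖ = 1
  n_dir : ‖nk P e D k - e‖ ≤ P.αn
  εn_eq : P.ε • nk P e D k =
    relPos P e D k (carrier P e D k) - θk P e D k • relVel D k (carrier P e D k)
  c_ge' : ‖relVel D k (carrier P e D k)‖ *
      (1 - ‖perpC (relPos P e D k (carrier P e D k)) (relVel D k (carrier P e D k))‖ ^ 2
        / P.ε ^ 2) ≤ ck P e D k
  c_ge : P.clo ≤ ck P e D k
  c_le : ck P e D k ≤ ‖relVel D k (carrier P e D k)‖

set_option maxHeartbeats 800000 in
/-- The stage-`k` geometric bounds give the contact of the transfer `k → k+1`. [folklore] -/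
theorem stepContact_of_geom (hP : P.Admissible) (hD : DataOK P e D) {k : ℕ}
    (hg : StepGeom P e D k) : StepContact P e D k := by
  set c := carrier P e D k with hc
  set Δ := D.ξ (k + 1) - D.ξ k + tHit P e D k • (D.η (k + 1) - D.η k) with hΔ
  set U := relVel D k c with hU
  have hε := hP.ε_pos
  have hVlo := hP.Vlo_pos
  have hUVlo : P.Vlo ≤ ‖U‖ := hg.U_ge
  have hUVhi : ‖U‖ ≤ P.Vhi := hg.U_le
  have hUpos : 0 < ‖U‖ := hVlo.trans_le hUVlo
  have hU0 : U ≠ 0 := norm_pos_iff.1 hUpos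
  have haΔ : relPos P e D k c = P.s • e + Δ := hg.Δ_eq
  obtain ⟨hp_le, hpar, hpε, hθlow, hθup, hn1, hndir, hclow, hcup⟩ :=
    transfer_geometry (Δ := Δ) (U := U) hD.e_unit hU0 hε hP.ε_lt_s hP.s_le hP.αp_nn hg.U_dir
      hg.Δ_le hP.small
  rw [← haΔ] at hp_le hpar hpε hθlow hθup hn1 hndir hclow hcup
  have hθk : θk P e D k = hitTime (relPos P e D k c) U P.ε := rfl
  have hnk : nk P e D k = P.ε⁻¹ • (relPos P e D k c - hitTime (relPos P e D k c) U P.ε • U) := rfl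
  have hck : ck P e D k = ⟪U, nk P e D k⟫_ℝ := rfl
  rw [← hnk] at hn1 hndir hclow hcup
  rw [← hck] at hclow hcup
  rw [← hθk] at hθlow hθup
  obtain ⟨hθpos, hcontact, hbefore, -, -⟩ := hitTime_spec hU0 hε hpε hpar
  rw [← hθk] at hθpos hcontact hbefore
  set p := ‖perpC (relPos P e D k c) U‖ with hp
  have hp0 : 0 ≤ p := norm_nonneg _
  have hp2 : p ^ 2 ≤ P.ps ^ 2 := pow_le_pow_left₀ hp0 hp_le 2
  have hx : p ^ 2 / P.ε ^ 2 ≤ P.ps ^ 2 / P.ε ^ 2 :=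
    div_le_div_of_nonneg_right hp2 (by positivity)
  have hpε2 : p ^ 2 / P.ε ≤ P.ps ^ 2 / P.ε := div_le_div_of_nonneg_right hp2 hε.le
  have hxle := hP.x_le
  have hg0 := hP.g_pos
  have hνs : P.νs = P.δs + P.ps ^ 2 / P.ε := rfl
  have hgdef : P.g = P.s - P.ε := rfl
  refine ⟨hp_le, hθpos, ?_, ?_, hcontact, hbefore, hn1, ?_, ?_, hclow, ?_, hcup⟩
  · refine le_trans ?_ hθlow
    unfold Params.θlo
    calc (P.g - P.νs) / P.Vhi ≤ (P.g - P.νs) / ‖U‖ :=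
          div_le_div_of_nonneg_left (by linarith [hP.νs_lt]) hUpos hUVhi
      _ ≤ (P.s - P.ε - (P.δs + p ^ 2 / P.ε)) / ‖U‖ :=
          div_le_div_of_nonneg_right (by linarith) hUpos.le
  · refine hθup.trans ?_
    unfold Params.θhi
    calc (P.s - P.ε + (P.δs + p ^ 2 / P.ε)) / ‖U‖ ≤ (P.g + P.νs) / ‖U‖ :=
          div_le_div_of_nonneg_right (by linarith) hUpos.le
      _ ≤ (P.g + P.νs) / P.Vlo :=
          div_le_div_of_nonneg_left (by linarith [hP.νs_nn]) hVlo hUVlo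
  · refine hndir.trans ?_
    unfold Params.αn
    refine div_le_div_of_nonneg_right ?_ hε.le
    rw [← hgdef]
    linarith
  · rw [hnk, smul_smul, mul_inv_cancel₀ hε.ne', one_smul, ← hθk]
  · refine le_trans ?_ hclow
    unfold Params.clo
    have h1 : 1 - P.ps ^ 2 / P.ε ^ 2 ≤ 1 - p ^ 2 / P.ε ^ 2 := by linarith
    have h2 : 0 ≤ 1 - P.ps ^ 2 / P.ε ^ 2 := by linarith
    exact mul_le_mul hUVlo h1 h2 (norm_nonneg _)


end BlockAnalysis

end BlockAll

end EquilibriumClampedCollisionalWindowLDNegative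

end Summit.AtomisticToContinuum.HydrodynamicLimit.Theorems

end
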